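import Summits.HodgeConjecture.HodgeConjecture.Theorems.Q8SymplecticPowersRegularOfFamilyOneFibre
import Summits.HodgeConjecture.HodgeConjecture.Theorems.Q8SymplecticPowersRegularOfDesingularization
import Summits.HodgeConjecture.HodgeConjecture.Theorems.Q8SymplecticPowersK1QPointwise
import Literature.AlgebraicGeometry.HodgeTheory.QuaternionicQuarticFamilyHolds
import HarnessLib

/-!
# K1Q line `mechanism-v2`: stub S1 POINTWISE IN `e`, and the `e = 4` case of the crux from ONE dense set of Betti-regular quartic planes

Route `HodgeConjecture/Q8SymplecticPowers`, crux K1Q `VeryGeneralQuaternionCommutatorsInHg` (stmt-HodgeConjecture-24190). Helper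
(`--supports stmt-HodgeConjecture-24190 --as helper`; nothing here closes an item; no definition; no named fact beyond the line's two print
inputs CDK 1995 ∕ Deligne 1987, hypotheses as in `Q8SymplecticPowersK1QPointwise`).

The reductions of S1 `stub_regularVeryGeneralQ` landed by the leaf hand q8symplecticpowers-1 (p793693 «one regular fibre of any smooth
projective family of quartic models», p798088 «(Z_b) a Zariski-dense set of members with `b₁ = 0`») are stated `∀ e → ∀ e` but proved
fibrewise in `e`. This file records the per-`e` statements (proofs = p793693 ∕ p798088 verbatim at one `e`) and plugs the `e = 4` one into
`Q8SymplecticPowersK1QPointwise.K1Q_at_four_of_residues`: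

* `regularAt_of_exists_regularFibre` — S1 AT `e` from one smooth projective family of quartic models at `e` with ONE fibre of `b₁ = 0`;
* `regularAt_of_dense_bettiRegularMembers` — S1 AT `e` (`e ≥ 4`) from (Z_b) AT `e`: for every `0 ≠ g ∈ ℂ[a]` some `a` with `g(a) ≠ 0`,
  `G_e(a) ≠ 0` and a smooth projective `X₀ ~bir 𝒱_a` with `b₁(X₀) = 0` (deformation invariance along the unconditional `qFamily_holds e`);
* `K1Q_at_four_of_dense_bettiRegularMembers` — **the `e = 4` case of the crux** from (Z_b)₄ «the Betti-regular quartic planes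
  `x₃⁴x₂⁸ = c (σc)³ ((x₀ − x₁)ψ)²`, `deg ψ = 3`, are Zariski dense», the registered LCERT₄, CDK and Deligne 1987 — nothing at `e ≥ 6`.

Residue of (Z_b)₄ in print: the irregularity of ONE explicit surface per basic open — the double cover of `𝔽₂` branched along
`E + f₁ + ⋯ + f₄ + C_ψ` (`C_ψ ∈ |3(E + 2f)|` smooth, nodal total branch curve), `L = 2E + 5f`, `q = h¹(𝔽₂, K + L) = h¹(𝔽₂, 𝒪(f)) = 0`
(Naie 2007 Thm. 3.1 for `n = 4`, `B = c + 3σc + 2(x₀ − x₁) + 2ψ`; no coherent-cohomology toolkit for it in the tree yet).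

Honest scope: reductions and a composition; S1, (Z_b), LCERT₄, CDK, Deligne 1987, K1Q and HC are NOT proved here.
-/

set_option linter.dupNamespace false
set_option maxHeartbeats 800000

noncomputable section

open CategoryTheory AlgebraicGeometry MonoidalCategory CartesianMonoidalCategory
open Literature.AlgebraicGeometry Literature.AlgebraicGeometry.Motives Literature.AlgebraicGeometry.HodgeTheory
open Literature.AlgebraicGeometry.HodgeTheory.BettiUniverse Literature.AlgebraicGeometry.HodgeTheory.Q8Family
open Literature.AlgebraicGeometry.RelativeSpec Literature.AlgebraicGeometry.RelativeSpec.ActionOver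

namespace Summit.HodgeConjecture.HodgeConjecture.Theorems.Q8SymplecticPowersRegularAt

/-- **S1 AT `e` from ONE regular fibre of ANY smooth projective family of quartic models at `e`** (= p793693
`stub_regularVeryGeneralQ_of_exists_regularFibre` at one `e`; proof verbatim: `W(ℂ)` path connected, Ehresmann constancy of `b₁`,
genericity polynomials with no bad set, birational invariance of `b₁`). [cite: VoisinHodgeI2002, §9.1.1 Thm. 9.3]
[cite: Hartshorne1977, II Ex. 8.8 and V Remark 5.6.1] -/
theorem regularAt_of_exists_regularFibre {e : ℕ}
    (H : ∃ (W : (Spec (.of (ParamRing e))).Opens) (𝒳 : SchemeOver ℂ) (π : 𝒳 ⟶ base W)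
      (g₀ : ParamRing e), g₀ ≠ 0 ∧ Nonempty (ComplexPoints (base W)) ∧ ∃ (_ : IsSmoothProjectiveFamily π 2)
      (_ : IsQuasiProjectiveOver (base W)) (_ : AlgebraicGeometry.SmoothOfRelativeDimension (Fintype.card (CIdx e)) (base W).hom),
      (∀ t : ComplexPoints (base W), MvPolynomial.eval (coeffs W t) g₀ ≠ 0 → ∀ ⦃V : SchemeOver ℂ⦄,
        IsHypersurfaceCutOutBy 3 (quarticForm e (cOf (coeffs W t)) (ψOf (coeffs W t))) V →
          AlgebraicGeometry.Scheme.BirationalOver (fiberOver π t).hom V.hom) ∧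
      ∃ a₀ : ComplexPoints (base W), Module.finrank ℚ (bettiCohomology (fiberOver π a₀) 1) = 0) :
    open Literature.AlgebraicGeometry.Motives Literature.AlgebraicGeometry.HodgeTheory Literature.AlgebraicGeometry.HodgeTheory.BettiUniverse CategoryTheory.Limits in ∃ G : ℕ → MvPolynomial ({d : Fin 3 →₀ ℕ // d.degree = 1} ⊕ {d : Fin 3 →₀ ℕ // d.degree = e - 1}) ℂ, (∀ i, ∃ c ψ : MvPolynomial (Fin 3) ℂ, c.IsHomogeneous 1 ∧ ψ.IsHomogeneous (e - 1) ∧ MvPolynomial.rename (Equiv.swap (0 : Fin 3) 1) ψ = ψ ∧ MvPolynomial.eval (Sum.elim (fun d => c.coeff d.1) (fun d => ψ.coeff d.1)) (G i) ≠ 0) ∧ ∀ c ψ : MvPolynomial (Fin 3) ℂ, c.IsHomogeneous 1 → ψ.IsHomogeneous (e - 1) → MvPolynomial.rename (Equiv.swap (0 : Fin 3) 1) ψ = ψ → (∀ i, MvPolynomial.eval (Sum.elim (fun d => c.coeff d.1) (fun d => ψ.coeff d.1)) (G i) ≠ 0) → ∀ ⦃V X : SchemeOver ℂ⦄ (hX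 : IsSmoothProjective 2 X), IsHypersurfaceCutOutBy 3 (MvPolynomial.X (Fin.last 3) ^ 4 * MvPolynomial.X (Fin.castSucc 2) ^ (2 * e) - MvPolynomial.rename Fin.castSucc (c * MvPolynomial.rename (Equiv.swap (0 : Fin 3) 1) c ^ 3 * ((MvPolynomial.X 0 - MvPolynomial.X 1) * ψ) ^ 2)) V → AlgebraicGeometry.Scheme.BirationalOver X.hom V.hom → Module.finrank ℚ (bettiCohomology X 1) = 0 := by
  obtain ⟨W, 𝒳, π, g₀, hg₀, hne, hπ, hqpW, hsm, hbir, a₀, ha₀⟩ := H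
  haveI := hsm
  haveI : PathConnectedSpace (ComplexPoints (base W)) :=
    Q8SymplecticPowersRegularOfOneFibre.pathConnectedSpace_complexPoints_base (m := Fintype.card (CIdx e)) W hne
  -- the genericity polynomials, with no bad set
  have hBad : ∀ j : ℕ, IsZariskiClosedOnPoints (base W) ((fun _ : ℕ => (∅ : Set (ComplexPoints (base W)))) j) ∧
      (fun _ : ℕ => (∅ : Set (ComplexPoints (base W)))) j ≠ Set.univ := by
    intro j'
    refine ⟨⟨∅, isClosed_empty, by ext P; simp⟩, ?_⟩
    obtain ⟨t₀⟩ := hne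
    intro h
    have ht₀ : t₀ ∈ (Set.univ : Set (ComplexPoints (base W))) := Set.mem_univ _
    rw [← h] at ht₀
    exact ht₀
  obtain ⟨G, hGne, hGpt⟩ := Q8SymplecticPowersGenericityPolynomials.exists_genericityPolynomials W hne (fun _ => ∅) hBad g₀ hg₀
  refine ⟨G, hGne, ?_⟩
  intro c ψ hc hψ hψσ hGi V X hX hV hbirX
  obtain ⟨t, htc, htψ, -, hGe⟩ := hGpt c ψ hc hψ hψσ hGi
  -- the fibre over `t` is birational to `V_(c,ψ)`, hence to `X`
  have hbV := hbir t hGe (V := V) (by rw [htc, htψ]; exact hV)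
  rw [finrank_bettiCohomology_one_eq_of_birationalOver hX (hπ.isSmoothProjective t) (hbirX.trans hbV.symm),
    finrank_bettiCohomology_fiberOver_eq_of_joined π hπ hqpW (d := Fintype.card (CIdx e)) (PathConnectedSpace.joined t a₀) 1]
  exact ha₀

/-- **S1 AT `e` from a Zariski-dense set of Betti-regular members AT `e`** (= p798088 at one `e`, `e ≥ 2` suffices; proof verbatim:
the unconditional smooth projective family `qFamily_holds e`, a non-zero `F` with `D(F)(ℂ) ⊆ W(ℂ)`, a regular member inside `D(F)`,
`X_{t₀} ~bir 𝒱_a ~bir X₀`). [cite: VoisinHodgeI2002, §9.1.1 Thm. 9.3 and §6.1.3 Cor. 6.13] [cite: Hartshorne1977, II Ex. 2.7 and V Remark 5.6.1] -/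
theorem regularAt_of_dense_bettiRegularMembers {e : ℕ} (he2 : 2 ≤ e)
    (HZ : ∀ g : ParamRing e, g ≠ 0 → ∃ a : CIdx e → ℂ, MvPolynomial.eval a g ≠ 0 ∧
      MvPolynomial.eval a (genericityElem e) ≠ 0 ∧ ∃ (X₀ : SchemeOver ℂ) (_ : IsSmoothProjective 2 X₀),
        AlgebraicGeometry.Scheme.BirationalOver X₀.hom (fiberSch e (MvPolynomial.eval a)).hom ∧
          Module.finrank ℚ (bettiCohomology X₀ 1) = 0) :
    open Literature.AlgebraicGeometry.Motives Literature.AlgebraicGeometry.HodgeTheory Literature.AlgebraicGeometry.HodgeTheory.BettiUniverse CategoryTheory.Limits in ∃ G : ℕ → MvPolynomial ({d : Fin 3 →₀ ℕ // d.degree = 1} ⊕ {d : Fin 3 →₀ ℕ // d.degree = e - 1}) ℂ, (∀ i, ∃ c ψ : MvPolynomial (Fin 3) ℂ, c.IsHomogeneous 1 ∧ ψ.IsHomogeneous (e - 1) ∧ MvPolynomial.rename (Equiv.swap (0 : Fin 3) 1) ψ = ψ ∧ MvPolynomial.eval (Sum.elim (fun d => c.coeff d.1) (fun d => ψ.coeff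 d.1)) (G i) ≠ 0) ∧ ∀ c ψ : MvPolynomial (Fin 3) ℂ, c.IsHomogeneous 1 → ψ.IsHomogeneous (e - 1) → MvPolynomial.rename (Equiv.swap (0 : Fin 3) 1) ψ = ψ → (∀ i, MvPolynomial.eval (Sum.elim (fun d => c.coeff d.1) (fun d => ψ.coeff d.1)) (G i) ≠ 0) → ∀ ⦃V X : SchemeOver ℂ⦄ (hX : IsSmoothProjective 2 X), IsHypersurfaceCutOutBy 3 (MvPolynomial.X (Fin.last 3) ^ 4 * MvPolynomial.X (Fin.castSucc 2) ^ (2 * e) - MvPolynomial.rename Fin.castSucc (c * MvPolynomial.rename (Equiv.swap (0 : Fin 3) 1) c ^ 3 * ((MvPolynomial.X 0 - MvPolynomial.X 1) * ψ) ^ 2)) V → AlgebraicGeometry.Scheme.BirationalOver X.hom V.hom → Module.finrank ℚ (bettiCohomology X 1) = 0 := by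
  refine regularAt_of_exists_regularFibre ?_
  -- the Kollár-free smooth projective family of quartic models
  obtain ⟨W, 𝒳, π, hne, hπ, -, hqpW, hsm, hbir⟩ := qFamily_holds e he2
  -- a non-zero `F` with `D(F)(ℂ) ⊆ W(ℂ)`
  obtain ⟨S₀, hS₀⟩ := Q8SymplecticPowersGenericityPolynomials.exists_set_exists_point_iff W
  have hF₀ : ∃ F ∈ S₀, F ≠ 0 := by
    obtain ⟨t⟩ := hne
    have h := (hS₀ (coeffs W t)).1 ⟨t, rfl⟩
    by_contra h'
    push Not at h'
    exact h fun F hFS => by rw [h' F hFS, map_zero]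
  obtain ⟨F, hFS, hF0⟩ := hF₀
  -- a regular member inside `D(F) ⊆ W`
  obtain ⟨a, hFa, hGa, X₀, hX₀, hbir₀, hq⟩ := HZ F hF0
  obtain ⟨t₀, ht₀⟩ : ∃ t : ComplexPoints (base W), coeffs W t = a :=
    (hS₀ a).2 fun hall => hFa (hall F hFS)
  refine ⟨W, 𝒳, π, 1, one_ne_zero, hne, hπ, hqpW, hsm, fun t _ V hV => hbir t hV, t₀, ?_⟩
  -- `X_{t₀} ~bir 𝒱_a ~bir X₀`, and `b₁(X₀) = 0`
  have hcut := (Q8SymplecticPowersRegularOfDesingularization.exists_desingularization_fiberSch he2 a hGa).1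
  rw [← ht₀] at hcut
  have h1 : AlgebraicGeometry.Scheme.BirationalOver (fiberOver π t₀).hom (fiberSch e (MvPolynomial.eval (coeffs W t₀))).hom :=
    hbir t₀ hcut
  rw [ht₀] at h1
  rw [finrank_bettiCohomology_one_eq_of_birationalOver (hπ.isSmoothProjective t₀) hX₀ (h1.trans hbir₀.symm)]
  exact hq

/-- **The `e = 4` case of the crux from (Z_b)₄, LCERT₄, CDK, Deligne 1987**: a Zariski-dense set of Betti-regular quartic planes
`x₃⁴x₂⁸ = c (σc)³ ((x₀ − x₁)ψ)²` (`deg ψ = 3`), the registered member local certificate at `e = 4`, and the two print inputs give the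
body of `VeryGeneralQuaternionCommutatorsInHg` at `e = 4` (through `Q8SymplecticPowersK1QPointwise.K1Q_at_four_of_residues`). Nothing
at `e ≥ 6` is used. [cite: CattaniDeligneKaplan1995, Thm. 1.1 and Cor. 1.2] [cite: Deligne1987, Prop. 1.13] -/
theorem K1Q_at_four_of_dense_bettiRegularMembers
    (HZ : ∀ g : ParamRing 4, g ≠ 0 → ∃ a : CIdx 4 → ℂ, MvPolynomial.eval a g ≠ 0 ∧
      MvPolynomial.eval a (genericityElem 4) ≠ 0 ∧ ∃ (X₀ : SchemeOver ℂ) (_ : IsSmoothProjective 2 X₀),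
        AlgebraicGeometry.Scheme.BirationalOver X₀.hom (fiberSch 4 (MvPolynomial.eval a)).hom ∧
          Module.finrank ℚ (bettiCohomology X₀ 1) = 0)
    (h₉₄ : open Literature.AlgebraicGeometry.Motives Literature.AlgebraicGeometry.HodgeTheory Literature.AlgebraicGeometry.HodgeTheory.BettiUniverse Literature.AlgebraicGeometry.HodgeTheory.Q8Family Literature.AlgebraicGeometry.RelativeSpec Literature.AlgebraicGeometry.RelativeSpec.ActionOver CategoryTheory CategoryTheory.Limits MonoidalCategory CartesianMonoidalCategory AlgebraicGeometry Literature.AlgebraicTopology.SingularHomology in ∀ ⦃e : ℕ⦄, e = 4 → ∃ (W : (Spec (.of (ParamRing e))).Opens) (𝒳 : SchemeOver ℂ) (π : 𝒳 ⟶ base W) (τ j : 𝒳 ⟶ 𝒳) (ι : (deckChart (fun i => (MvPolynomial.X i : ParamRing e)) ⊗ Over.mk W.ι).left ⟶ 𝒳.left), ∃ (_ : Nonempty (ComplexPoints (base W))) (hπ : IsSmoothProjectiveFamily π 2) (_ : IsQuasiProjectiveOver 𝒳) (_ : IsQuasiProjectiveOver (base W)) (_ : AlgebraicGeometry.SmoothOfRelativeDimension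 (Fintype.card (CIdx e)) (base W).hom) (hτπ : τ ≫ π = π) (hjπ : j ≫ π = π) (_ : τ ≫ τ ≫ τ ≫ τ = 𝟙 𝒳) (_ : j ≫ j = τ ≫ τ) (_ : τ ≫ j ≫ τ = j) (_ : IsOpenImmersion ι) (_ : ι ≫ π.left = (snd (deckChart (fun i => (MvPolynomial.X i : ParamRing e))) (Over.mk W.ι)).left) (_ : ((Over.isoMk ((deckAction (fun i => (MvPolynomial.X i : ParamRing e))).aut (QuaternionGroup.a 1)) ((deckAction (fun i => (MvPolynomial.X i : ParamRing e))).aut_comp (QuaternionGroup.a 1))).hom ▷ Over.mk W.ι).left ≫ ι = ι ≫ τ.left) (_ : ((Over.isoMk ((deckAction (fun i => (MvPolynomial.X i : ParamRing e))).aut (QuaternionGroup.xa 0)) ((deckAction (fun i => (MvPolynomial.X i : ParamRing e))).aut_comp (QuaternionGroup.xa 0))).hom ▷ Over.mk W.ι).left ≫ ι = ι ≫ j.left) (_ : Function.Surjective (snd (deckChart (fun i => (MvPolynomial.X i : ParamRing e))) (Over.mk W.ι)).left), ∀ (hU : IsCohomologicallyLocallyTrivialOn π Set.univ), ∃ (b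 : ComplexPoints (base W)) (ψ : OpenPartialHomeomorph (Set.univ : Set (ComplexPoints (base W))) (Fin (Fintype.card (CIdx e)) → ℂ)) (W₀ : Set (Set.univ : Set (ComplexPoints (base W)))) (ω : (Fin (Fintype.card (CIdx e)) → ℂ) → TensorProduct ℚ ℂ (bettiCohomology (fiberOver π b) 2)) (r : ℕ), IsOpen W₀ ∧ (⟨b, Set.mem_univ b⟩ : (Set.univ : Set (ComplexPoints (base W)))) ∈ W₀ ∧ W₀ ⊆ ψ.source ∧ (let Xb := fiberOver π b; let hXb : IsSmoothProjective 2 Xb := hπ.isSmoothProjective b; let Ab : bettiCohomology Xb 2 →ₗ[ℚ] bettiCohomology Xb 2 := pull (fiberOverEnd π τ hτπ b) 2; let Mb : Submodule ℂ (TensorProduct ℚ ℂ (bettiCohomology Xb 2)) := Module.End.eigenspace (Ab.baseChange ℂ) Complex.I; Module.finrank ℂ ↥(Module.End.eigenspace ((Ab ^ 2).baseChange ℂ) 1 ⊓ (hodge exists_isReal_hodgeModel_holds hXb 2).piece 2 0) = 0 ∧ 0 < Module.finrank ℂ ↥(Module.End.eigenspace ((Ab ^ 2).baseChange ℂ) (-1)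 ⊓ (hodge exists_isReal_hodgeModel_holds hXb 2).piece 2 0) ∧ 6 ≤ Module.finrank ℂ ↥Mb ∧ Module.finrank ℂ ↥(Mb ⊓ (hodge exists_isReal_hodgeModel_holds hXb 2).F 2) ≤ 1 ∧ (∀ t ∈ W₀, ∀ (ε : Path (⟨b, Set.mem_univ b⟩ : (Set.univ : Set (ComplexPoints (base W)))) t), (∀ r', ε r' ∈ W₀) → ∀ (T : bettiCohomology Xb 2 ≃ₗ[ℚ] bettiCohomology (fiberOver π t.1) 2), (∀ v, ofRatClass _ 2 (T v) = transportFun π 2 hU ⟦ε⟧ (ofRatClass _ 2 v)) → ω (ψ t) ∈ Mb ⊓ ((hodge exists_isReal_hodgeModel_holds (hπ.isSmoothProjective t.1) 2).comapEquiv T).F 2) ∧ (∀ φ : Module.Dual ℂ (TensorProduct ℚ ℂ (bettiCohomology Xb 2)), (∀ i ≤ r, iteratedFDeriv ℂ i (fun z ↦ φ (ω z)) (ψ ⟨b, Set.mem_univ b⟩) = 0) → ∀ m ∈ Mb, φ m = 0)) ∧ ∃ (γ : bettiCohomology (fiberOver π b) 2 ≃ₗ[ℚ] bettiCohomology (fiberOver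 π b) 2), γ ∈ ratMonodromyGroup π 2 hU ⟨b, Set.mem_univ b⟩ ∧ (∃ a, pull (fiberOverEnd π τ hτπ b) 2 (pull (fiberOverEnd π τ hτπ b) 2 a) = -a ∧ γ a ≠ a) ∧ ∃ (h : ComplexPoints (fiberOver π b) ≃ₜ ComplexPoints (fiberOver π b)), (∀ a, γ a = (singularCohomology.map ℚ ℚ (h : C(ComplexPoints (fiberOver π b), ComplexPoints (fiberOver π b))) 2).hom a) ∧ singularHomology.map ℚ ℚ (h : C(ComplexPoints (fiberOver π b), ComplexPoints (fiberOver π b))) 4 (complexOrientationRat (hπ.isSmoothProjective b)).fundamentalClass = (complexOrientationRat (hπ.isSmoothProjective b)).fundamentalClass ∧ (∀ x, h ((AlgPoints.mapContinuous (L := ℂ) (fiberOverEnd π τ hτπ b)) x) = (AlgPoints.mapContinuous (L := ℂ) (fiberOverEnd π τ hτπ b)) (h x)) ∧ ∃ (A₁ A₂ B : Set (ComplexPoints (fiberOver π b))), IsOpen A₁ ∧ IsOpen A₂ ∧ IsOpen B ∧ A₁ ∪ A₂ ∪ B = Set.univ ∧ Disjoint (closure A₁) A₂ ∧ (∀ x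 ∈ B, h x = x) ∧ ∃ (hhA₁ : Set.MapsTo (h : C(ComplexPoints (fiberOver π b), ComplexPoints (fiberOver π b))) A₁ A₁) (hhA₂ : Set.MapsTo (h : C(ComplexPoints (fiberOver π b), ComplexPoints (fiberOver π b))) A₂ A₂) (hτA₁ : Set.MapsTo (AlgPoints.mapContinuous (L := ℂ) (fiberOverEnd π τ hτπ b)) A₁ A₁) (hτA₂ : Set.MapsTo (AlgPoints.mapContinuous (L := ℂ) (fiberOverEnd π τ hτπ b)) A₂ A₂) (_ : Set.MapsTo (AlgPoints.mapContinuous (L := ℂ) (fiberOverEnd π j hjπ b)) A₁ A₂) (_ : Set.MapsTo (AlgPoints.mapContinuous (L := ℂ) (fiberOverEnd π j hjπ b)) A₂ A₁) (_ : Module.Finite ℚ (singularHomology ℚ ℚ (↥A₁) 2)) (_ : Module.Finite ℚ (singularHomology ℚ ℚ (↥A₂) 2)), Module.finrank ℚ ↥(Module.End.eigenspace ((singularHomology.map ℚ ℚ (singularHomology.restrictSelf (AlgPoints.mapContinuous (L := ℂ) (fiberOverEnd π τ hτπ b)) hτA₁) 2).hom ^ 2) (-1 : ℚ)) ≤ 2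 ∧ (∀ a : singularHomology ℚ ℚ (↥A₁) 2, singularHomology.map ℚ ℚ (singularHomology.restrictSelf (AlgPoints.mapContinuous (L := ℂ) (fiberOverEnd π τ hτπ b)) hτA₁) 2 (singularHomology.map ℚ ℚ (singularHomology.restrictSelf (AlgPoints.mapContinuous (L := ℂ) (fiberOverEnd π τ hτπ b)) hτA₁) 2 a) = -a → singularHomology.map ℚ ℚ (singularHomology.restrictSelf (h : C(ComplexPoints (fiberOver π b), ComplexPoints (fiberOver π b))) hhA₁) 2 a = singularHomology.map ℚ ℚ (singularHomology.restrictSelf (AlgPoints.mapContinuous (L := ℂ) (fiberOverEnd π τ hτπ b)) hτA₁) 2 a) ∧ (∀ a : singularHomology ℚ ℚ (↥A₂) 2, singularHomology.map ℚ ℚ (singularHomology.restrictSelf (AlgPoints.mapContinuous (L := ℂ) (fiberOverEnd π τ hτπ b)) hτA₂) 2 (singularHomology.map ℚ ℚ (singularHomology.restrictSelf (AlgPoints.mapContinuous (L := ℂ) (fiberOverEnd π τ hτπ b)) hτA₂) 2 a) = -a → singularHomology.map ℚ ℚ (singularHomology.restrictSelf (h : C(ComplexPoints (fiberOver π b), ComplexPoints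 (fiberOver π b))) hhA₂) 2 (singularHomology.map ℚ ℚ (singularHomology.restrictSelf (AlgPoints.mapContinuous (L := ℂ) (fiberOverEnd π τ hτπ b)) hτA₂) 2 a) = a))
    (hcdk : open Literature.AlgebraicGeometry.HodgeTheory in cmsp_nonHodgeGenericPoints_countable_algebraic_cover)
    (hdel : Literature.AlgebraicGeometry.HodgeTheory.deligne1987_monodromy_directSum_irreducible_subvariations) :
    open Literature.AlgebraicGeometry.Motives Literature.AlgebraicGeometry.HodgeTheory Literature.AlgebraicGeometry.HodgeTheory.BettiUniverse Literature.AlgebraicGeometry.HodgeTheory.Q8Family Literature.AlgebraicGeometry.RelativeSpec Literature.AlgebraicGeometry.RelativeSpec.ActionOver Literature.Algebra.Lie Literature.Algebra.Lie.KatzRecognition CategoryTheory CategoryTheory.Limits MonoidalCategory CartesianMonoidalCategory AlgebraicGeometry in let Uni : (X : SchemeOver ℂ) → IsSmoothProjective 2 X → (X ⟶ X) → (X ⟶ X) → (bettiCohomology X 2 ≃ₗ[ℚ] bettiCohomology X 2) → Prop := fun X hX τ j g => (∀ x, g (pull τ 2 x) = pull τ 2 (g x)) ∧ (∀ x, g (pull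 j 2 x) = pull j 2 (g x)) ∧ (∀ x y, tr hX (2 + 2) (cup X 2 2 (g x) (g y)) = tr hX (2 + 2) (cup X 2 2 x y)) ∧ ∀ x ∈ (hodge exists_isReal_hodgeModel_holds hX 2).hodgeClasses 1, g x = x; let Comm : (X : SchemeOver ℂ) → IsSmoothProjective 2 X → (X ⟶ X) → (X ⟶ X) → Prop := fun X hX τ j => haveI := finite hX 2; haveI : HodgeTensorFacts.{0, 0} := hodgeTensorFacts_holds; ∀ g h : bettiCohomology X 2 ≃ₗ[ℚ] bettiCohomology X 2, Uni X hX τ j g → Uni X hX τ j h → g * h * g⁻¹ * h⁻¹ ∈ (hodge exists_isReal_hodgeModel_holds hX 2).hodgeGroup; ∀ ⦃e : ℕ⦄, e = 4 → ∃ G : ℕ → MvPolynomial ({d : Fin 3 →₀ ℕ // d.degree = 1} ⊕ {d : Fin 3 →₀ ℕ // d.degree = e - 1}) ℂ, (∀ i, ∃ c ψ : MvPolynomial (Fin 3) ℂ, c.IsHomogeneous 1 ∧ ψ.IsHomogeneous (e - 1) ∧ MvPolynomial.rename (Equiv.swap (0 : Fin 3) 1) ψ = ψ ∧ MvPolynomial.eval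 (Sum.elim (fun d => c.coeff d.1) (fun d => ψ.coeff d.1)) (G i) ≠ 0) ∧ ∀ c ψ : MvPolynomial (Fin 3) ℂ, c.IsHomogeneous 1 → ψ.IsHomogeneous (e - 1) → MvPolynomial.rename (Equiv.swap (0 : Fin 3) 1) ψ = ψ → (∀ i, MvPolynomial.eval (Sum.elim (fun d => c.coeff d.1) (fun d => ψ.coeff d.1)) (G i) ≠ 0) → ∀ ⦃V X : SchemeOver ℂ⦄ (hX : IsSmoothProjective 2 X), IsHypersurfaceCutOutBy 3 (MvPolynomial.X (Fin.last 3) ^ 4 * MvPolynomial.X (Fin.castSucc 2) ^ (2 * e) - MvPolynomial.rename Fin.castSucc (c * MvPolynomial.rename (Equiv.swap (0 : Fin 3) 1) c ^ 3 * ((MvPolynomial.X 0 - MvPolynomial.X 1) * ψ) ^ 2)) V → AlgebraicGeometry.Scheme.BirationalOver X.hom V.hom → Module.finrank ℚ (bettiCohomology X 1) = 0 ∧ ∀ τ j : X ⟶ X, (pull τ 2 ^ 4 = 1 ∧ pull j 2 ^ 2 = pull τ 2 ^ 2 ∧ pull j 2 * pull τ 2 = pull τ 2 ^ 3 * pull j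 2 ∧ Module.finrank ℂ ↥(Module.End.eigenspace ((pull τ 2 ^ 2).baseChange ℂ) 1 ⊓ (hodge exists_isReal_hodgeModel_holds hX 2).piece 2 0) = 0 ∧ 0 < Module.finrank ℂ ↥(Module.End.eigenspace ((pull τ 2 ^ 2).baseChange ℂ) (-1) ⊓ (hodge exists_isReal_hodgeModel_holds hX 2).piece 2 0)) → Comm X hX τ j :=
  Q8SymplecticPowersK1QPointwise.K1Q_at_four_of_residues
    (fun e he4 => by subst he4; exact regularAt_of_dense_bettiRegularMembers (by norm_num) HZ) h₉₄ @hcdk @hdel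

/-- **The crux through the two cases, with S1 supplied pointwise by (Z_b)**: (Z_b) (all even `e ≥ 4`, the hypothesis of p798088
verbatim), LCERT₄, LCERT_{≥6}, CDK, Deligne 1987 ⊢ `VeryGeneralQuaternionCommutatorsInHg` — the `e = 4` case through
`K1Q_at_four_of_dense_bettiRegularMembers`, the cases `e ≥ 6` through `Q8SymplecticPowersK1QPointwise.K1Q_at_ge6_of_residues`.
[cite: CattaniDeligneKaplan1995, Thm. 1.1 and Cor. 1.2] [cite: Deligne1987, Prop. 1.13] -/
theorem VeryGeneralQuaternionCommutatorsInHg_of_dense_bettiRegularMembers_cases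
    (HZ : ∀ ⦃e : ℕ⦄, Even e → 4 ≤ e → ∀ g : ParamRing e, g ≠ 0 → ∃ a : CIdx e → ℂ, MvPolynomial.eval a g ≠ 0 ∧
      MvPolynomial.eval a (genericityElem e) ≠ 0 ∧ ∃ (X₀ : SchemeOver ℂ) (_ : IsSmoothProjective 2 X₀),
        AlgebraicGeometry.Scheme.BirationalOver X₀.hom (fiberSch e (MvPolynomial.eval a)).hom ∧
          Module.finrank ℚ (bettiCohomology X₀ 1) = 0)
    (h₉₄ : open Literature.AlgebraicGeometry.Motives Literature.AlgebraicGeometry.HodgeTheory Literature.AlgebraicGeometry.HodgeTheory.BettiUniverse Literature.AlgebraicGeometry.HodgeTheory.Q8Family Literature.AlgebraicGeometry.RelativeSpec Literature.AlgebraicGeometry.RelativeSpec.ActionOver CategoryTheory CategoryTheory.Limits MonoidalCategory CartesianMonoidalCategory AlgebraicGeometry Literature.AlgebraicTopology.SingularHomology in ∀ ⦃e : ℕ⦄, e = 4 → ∃ (W : (Spec (.of (ParamRing e))).Opens) (𝒳 : SchemeOver ℂ) (π : 𝒳 ⟶ base W) (τ j : 𝒳 ⟶ 𝒳) (ι : (deckChart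 (fun i => (MvPolynomial.X i : ParamRing e)) ⊗ Over.mk W.ι).left ⟶ 𝒳.left), ∃ (_ : Nonempty (ComplexPoints (base W))) (hπ : IsSmoothProjectiveFamily π 2) (_ : IsQuasiProjectiveOver 𝒳) (_ : IsQuasiProjectiveOver (base W)) (_ : AlgebraicGeometry.SmoothOfRelativeDimension (Fintype.card (CIdx e)) (base W).hom) (hτπ : τ ≫ π = π) (hjπ : j ≫ π = π) (_ : τ ≫ τ ≫ τ ≫ τ = 𝟙 𝒳) (_ : j ≫ j = τ ≫ τ) (_ : τ ≫ j ≫ τ = j) (_ : IsOpenImmersion ι) (_ : ι ≫ π.left = (snd (deckChart (fun i => (MvPolynomial.X i : ParamRing e))) (Over.mk W.ι)).left) (_ : ((Over.isoMk ((deckAction (fun i => (MvPolynomial.X i : ParamRing e))).aut (QuaternionGroup.a 1)) ((deckAction (fun i => (MvPolynomial.X i : ParamRing e))).aut_comp (QuaternionGroup.a 1))).hom ▷ Over.mk W.ι).left ≫ ι = ι ≫ τ.left) (_ : ((Over.isoMk ((deckAction (fun i => (MvPolynomial.X i : ParamRing e))).aut (QuaternionGroup.xa 0)) ((deckAction (fun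 i => (MvPolynomial.X i : ParamRing e))).aut_comp (QuaternionGroup.xa 0))).hom ▷ Over.mk W.ι).left ≫ ι = ι ≫ j.left) (_ : Function.Surjective (snd (deckChart (fun i => (MvPolynomial.X i : ParamRing e))) (Over.mk W.ι)).left), ∀ (hU : IsCohomologicallyLocallyTrivialOn π Set.univ), ∃ (b : ComplexPoints (base W)) (ψ : OpenPartialHomeomorph (Set.univ : Set (ComplexPoints (base W))) (Fin (Fintype.card (CIdx e)) → ℂ)) (W₀ : Set (Set.univ : Set (ComplexPoints (base W)))) (ω : (Fin (Fintype.card (CIdx e)) → ℂ) → TensorProduct ℚ ℂ (bettiCohomology (fiberOver π b) 2)) (r : ℕ), IsOpen W₀ ∧ (⟨b, Set.mem_univ b⟩ : (Set.univ : Set (ComplexPoints (base W)))) ∈ W₀ ∧ W₀ ⊆ ψ.source ∧ (let Xb := fiberOver π b; let hXb : IsSmoothProjective 2 Xb := hπ.isSmoothProjective b; let Ab : bettiCohomology Xb 2 →ₗ[ℚ] bettiCohomology Xb 2 := pull (fiberOverEnd π τ hτπ b) 2; let Mb : Submodule ℂ (TensorProduct ℚ ℂ (bettiCohomology Xb 2))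 := Module.End.eigenspace (Ab.baseChange ℂ) Complex.I; Module.finrank ℂ ↥(Module.End.eigenspace ((Ab ^ 2).baseChange ℂ) 1 ⊓ (hodge exists_isReal_hodgeModel_holds hXb 2).piece 2 0) = 0 ∧ 0 < Module.finrank ℂ ↥(Module.End.eigenspace ((Ab ^ 2).baseChange ℂ) (-1) ⊓ (hodge exists_isReal_hodgeModel_holds hXb 2).piece 2 0) ∧ 6 ≤ Module.finrank ℂ ↥Mb ∧ Module.finrank ℂ ↥(Mb ⊓ (hodge exists_isReal_hodgeModel_holds hXb 2).F 2) ≤ 1 ∧ (∀ t ∈ W₀, ∀ (ε : Path (⟨b, Set.mem_univ b⟩ : (Set.univ : Set (ComplexPoints (base W)))) t), (∀ r', ε r' ∈ W₀) → ∀ (T : bettiCohomology Xb 2 ≃ₗ[ℚ] bettiCohomology (fiberOver π t.1) 2), (∀ v, ofRatClass _ 2 (T v) = transportFun π 2 hU ⟦ε⟧ (ofRatClass _ 2 v)) → ω (ψ t) ∈ Mb ⊓ ((hodge exists_isReal_hodgeModel_holds (hπ.isSmoothProjective t.1) 2).comapEquiv T).F 2) ∧ (∀ φ : Module.Dual ℂ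 (TensorProduct ℚ ℂ (bettiCohomology Xb 2)), (∀ i ≤ r, iteratedFDeriv ℂ i (fun z ↦ φ (ω z)) (ψ ⟨b, Set.mem_univ b⟩) = 0) → ∀ m ∈ Mb, φ m = 0)) ∧ ∃ (γ : bettiCohomology (fiberOver π b) 2 ≃ₗ[ℚ] bettiCohomology (fiberOver π b) 2), γ ∈ ratMonodromyGroup π 2 hU ⟨b, Set.mem_univ b⟩ ∧ (∃ a, pull (fiberOverEnd π τ hτπ b) 2 (pull (fiberOverEnd π τ hτπ b) 2 a) = -a ∧ γ a ≠ a) ∧ ∃ (h : ComplexPoints (fiberOver π b) ≃ₜ ComplexPoints (fiberOver π b)), (∀ a, γ a = (singularCohomology.map ℚ ℚ (h : C(ComplexPoints (fiberOver π b), ComplexPoints (fiberOver π b))) 2).hom a) ∧ singularHomology.map ℚ ℚ (h : C(ComplexPoints (fiberOver π b), ComplexPoints (fiberOver π b))) 4 (complexOrientationRat (hπ.isSmoothProjective b)).fundamentalClass = (complexOrientationRat (hπ.isSmoothProjective b)).fundamentalClass ∧ (∀ x, h ((AlgPoints.mapContinuous (L := ℂ) (fiberOverEnd π τ hτπ b))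 x) = (AlgPoints.mapContinuous (L := ℂ) (fiberOverEnd π τ hτπ b)) (h x)) ∧ ∃ (A₁ A₂ B : Set (ComplexPoints (fiberOver π b))), IsOpen A₁ ∧ IsOpen A₂ ∧ IsOpen B ∧ A₁ ∪ A₂ ∪ B = Set.univ ∧ Disjoint (closure A₁) A₂ ∧ (∀ x ∈ B, h x = x) ∧ ∃ (hhA₁ : Set.MapsTo (h : C(ComplexPoints (fiberOver π b), ComplexPoints (fiberOver π b))) A₁ A₁) (hhA₂ : Set.MapsTo (h : C(ComplexPoints (fiberOver π b), ComplexPoints (fiberOver π b))) A₂ A₂) (hτA₁ : Set.MapsTo (AlgPoints.mapContinuous (L := ℂ) (fiberOverEnd π τ hτπ b)) A₁ A₁) (hτA₂ : Set.MapsTo (AlgPoints.mapContinuous (L := ℂ) (fiberOverEnd π τ hτπ b)) A₂ A₂) (_ : Set.MapsTo (AlgPoints.mapContinuous (L := ℂ) (fiberOverEnd π j hjπ b)) A₁ A₂) (_ : Set.MapsTo (AlgPoints.mapContinuous (L := ℂ) (fiberOverEnd π j hjπ b)) A₂ A₁) (_ : Module.Finite ℚ (singularHomology ℚ ℚ (↥A₁)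 2)) (_ : Module.Finite ℚ (singularHomology ℚ ℚ (↥A₂) 2)), Module.finrank ℚ ↥(Module.End.eigenspace ((singularHomology.map ℚ ℚ (singularHomology.restrictSelf (AlgPoints.mapContinuous (L := ℂ) (fiberOverEnd π τ hτπ b)) hτA₁) 2).hom ^ 2) (-1 : ℚ)) ≤ 2 ∧ (∀ a : singularHomology ℚ ℚ (↥A₁) 2, singularHomology.map ℚ ℚ (singularHomology.restrictSelf (AlgPoints.mapContinuous (L := ℂ) (fiberOverEnd π τ hτπ b)) hτA₁) 2 (singularHomology.map ℚ ℚ (singularHomology.restrictSelf (AlgPoints.mapContinuous (L := ℂ) (fiberOverEnd π τ hτπ b)) hτA₁) 2 a) = -a → singularHomology.map ℚ ℚ (singularHomology.restrictSelf (h : C(ComplexPoints (fiberOver π b), ComplexPoints (fiberOver π b))) hhA₁) 2 a = singularHomology.map ℚ ℚ (singularHomology.restrictSelf (AlgPoints.mapContinuous (L := ℂ) (fiberOverEnd π τ hτπ b)) hτA₁) 2 a) ∧ (∀ a : singularHomology ℚ ℚ (↥A₂) 2, singularHomology.map ℚ ℚ (singularHomology.restrictSelf (AlgPoints.mapContinuous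 (L := ℂ) (fiberOverEnd π τ hτπ b)) hτA₂) 2 (singularHomology.map ℚ ℚ (singularHomology.restrictSelf (AlgPoints.mapContinuous (L := ℂ) (fiberOverEnd π τ hτπ b)) hτA₂) 2 a) = -a → singularHomology.map ℚ ℚ (singularHomology.restrictSelf (h : C(ComplexPoints (fiberOver π b), ComplexPoints (fiberOver π b))) hhA₂) 2 (singularHomology.map ℚ ℚ (singularHomology.restrictSelf (AlgPoints.mapContinuous (L := ℂ) (fiberOverEnd π τ hτπ b)) hτA₂) 2 a) = a))
    (h₉₆ : open Literature.AlgebraicGeometry.Motives Literature.AlgebraicGeometry.HodgeTheory Literature.AlgebraicGeometry.HodgeTheory.BettiUniverse Literature.AlgebraicGeometry.HodgeTheory.Q8Family Literature.AlgebraicGeometry.RelativeSpec Literature.AlgebraicGeometry.RelativeSpec.ActionOver CategoryTheory CategoryTheory.Limits MonoidalCategory CartesianMonoidalCategory AlgebraicGeometry Literature.AlgebraicTopology.SingularHomology in ∀ ⦃e : ℕ⦄, Even e → 6 ≤ e → ∃ (W : (Spec (.of (ParamRing e))).Opens) (𝒳 : SchemeOver ℂ) (π : 𝒳 ⟶ base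 W) (τ j : 𝒳 ⟶ 𝒳) (ι : (deckChart (fun i => (MvPolynomial.X i : ParamRing e)) ⊗ Over.mk W.ι).left ⟶ 𝒳.left), ∃ (_ : Nonempty (ComplexPoints (base W))) (hπ : IsSmoothProjectiveFamily π 2) (_ : IsQuasiProjectiveOver 𝒳) (_ : IsQuasiProjectiveOver (base W)) (_ : AlgebraicGeometry.SmoothOfRelativeDimension (Fintype.card (CIdx e)) (base W).hom) (hτπ : τ ≫ π = π) (hjπ : j ≫ π = π) (_ : τ ≫ τ ≫ τ ≫ τ = 𝟙 𝒳) (_ : j ≫ j = τ ≫ τ) (_ : τ ≫ j ≫ τ = j) (_ : IsOpenImmersion ι) (_ : ι ≫ π.left = (snd (deckChart (fun i => (MvPolynomial.X i : ParamRing e))) (Over.mk W.ι)).left) (_ : ((Over.isoMk ((deckAction (fun i => (MvPolynomial.X i : ParamRing e))).aut (QuaternionGroup.a 1)) ((deckAction (fun i => (MvPolynomial.X i : ParamRing e))).aut_comp (QuaternionGroup.a 1))).hom ▷ Over.mk W.ι).left ≫ ι = ι ≫ τ.left) (_ : ((Over.isoMk ((deckAction (fun i => (MvPolynomial.X i : ParamRing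 e))).aut (QuaternionGroup.xa 0)) ((deckAction (fun i => (MvPolynomial.X i : ParamRing e))).aut_comp (QuaternionGroup.xa 0))).hom ▷ Over.mk W.ι).left ≫ ι = ι ≫ j.left) (_ : Function.Surjective (snd (deckChart (fun i => (MvPolynomial.X i : ParamRing e))) (Over.mk W.ι)).left), ∀ (hU : IsCohomologicallyLocallyTrivialOn π Set.univ), ∃ (b : ComplexPoints (base W)) (ψ : OpenPartialHomeomorph (Set.univ : Set (ComplexPoints (base W))) (Fin (Fintype.card (CIdx e)) → ℂ)) (W₀ : Set (Set.univ : Set (ComplexPoints (base W)))) (ι₁ ι₂ : Type) (ω : (Fin (Fintype.card (CIdx e)) → ℂ) → ι₁ → TensorProduct ℚ ℂ (bettiCohomology (fiberOver π b) 2)) (η : (Fin (Fintype.card (CIdx e)) → ℂ) → ι₂ → Module.Dual ℂ (TensorProduct ℚ ℂ (bettiCohomology (fiberOver π b) 2))) (r : ℕ), IsOpen W₀ ∧ (⟨b, Set.mem_univ b⟩ : (Set.univ : Set (ComplexPoints (base W)))) ∈ W₀ ∧ W₀ ⊆ ψ.source ∧ (let Xb := fiberOver π b; let hXb : IsSmoothProjective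 2 Xb := hπ.isSmoothProjective b; let Ab : bettiCohomology Xb 2 →ₗ[ℚ] bettiCohomology Xb 2 := pull (fiberOverEnd π τ hτπ b) 2; let Mb : Submodule ℂ (TensorProduct ℚ ℂ (bettiCohomology Xb 2)) := Module.End.eigenspace (Ab.baseChange ℂ) Complex.I; Module.finrank ℂ ↥(Module.End.eigenspace ((Ab ^ 2).baseChange ℂ) 1 ⊓ (hodge exists_isReal_hodgeModel_holds hXb 2).piece 2 0) = 0 ∧ 0 < Module.finrank ℂ ↥(Module.End.eigenspace ((Ab ^ 2).baseChange ℂ) (-1) ⊓ (hodge exists_isReal_hodgeModel_holds hXb 2).piece 2 0) ∧ 6 ≤ Module.finrank ℂ ↥Mb ∧ (∀ t ∈ W₀, ∀ (ε : Path (⟨b, Set.mem_univ b⟩ : (Set.univ : Set (ComplexPoints (base W)))) t), (∀ r', ε r' ∈ W₀) → ∀ (T : bettiCohomology Xb 2 ≃ₗ[ℚ] bettiCohomology (fiberOver π t.1) 2), (∀ v, ofRatClass _ 2 (T v) = transportFun π 2 hU ⟦ε⟧ (ofRatClass _ 2 v)) → ∀ i, ω (ψ t) i ∈ Mb ⊓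 ((hodge exists_isReal_hodgeModel_holds (hπ.isSmoothProjective t.1) 2).comapEquiv T).F 2) ∧ (∀ t ∈ W₀, ∀ (ε : Path (⟨b, Set.mem_univ b⟩ : (Set.univ : Set (ComplexPoints (base W)))) t), (∀ r', ε r' ∈ W₀) → ∀ (T : bettiCohomology Xb 2 ≃ₗ[ℚ] bettiCohomology (fiberOver π t.1) 2), (∀ v, ofRatClass _ 2 (T v) = transportFun π 2 hU ⟦ε⟧ (ofRatClass _ 2 v)) → ∀ l, ∀ x ∈ Mb ⊓ ((hodge exists_isReal_hodgeModel_holds (hπ.isSmoothProjective t.1) 2).comapEquiv T).F 2, η (ψ t) l x = 0) ∧ (∀ φ : (TensorProduct ℚ ℂ (bettiCohomology Xb 2)) →ₗ[ℂ] (TensorProduct ℚ ℂ (bettiCohomology Xb 2)), (∀ x ∈ Mb, φ x ∈ Mb) → (∀ i l, ∀ m ≤ r, iteratedFDeriv ℂ m (fun z ↦ η z l (φ (ω z i))) (ψ ⟨b, Set.mem_univ b⟩) = 0) → ∃ c : ℂ, ∀ x ∈ Mb, φ x = c • x)) ∧ ∃ (γ : bettiCohomology (fiberOver π b) 2 ≃ₗ[ℚ]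 bettiCohomology (fiberOver π b) 2), γ ∈ ratMonodromyGroup π 2 hU ⟨b, Set.mem_univ b⟩ ∧ (∃ a, pull (fiberOverEnd π τ hτπ b) 2 (pull (fiberOverEnd π τ hτπ b) 2 a) = -a ∧ γ a ≠ a) ∧ ∃ (h : ComplexPoints (fiberOver π b) ≃ₜ ComplexPoints (fiberOver π b)), (∀ a, γ a = (singularCohomology.map ℚ ℚ (h : C(ComplexPoints (fiberOver π b), ComplexPoints (fiberOver π b))) 2).hom a) ∧ singularHomology.map ℚ ℚ (h : C(ComplexPoints (fiberOver π b), ComplexPoints (fiberOver π b))) 4 (complexOrientationRat (hπ.isSmoothProjective b)).fundamentalClass = (complexOrientationRat (hπ.isSmoothProjective b)).fundamentalClass ∧ (∀ x, h ((AlgPoints.mapContinuous (L := ℂ) (fiberOverEnd π τ hτπ b)) x) = (AlgPoints.mapContinuous (L := ℂ) (fiberOverEnd π τ hτπ b)) (h x)) ∧ ∃ (A₁ A₂ B : Set (ComplexPoints (fiberOver π b))), IsOpen A₁ ∧ IsOpen A₂ ∧ IsOpen B ∧ A₁ ∪ A₂ ∪ B = Set.univ ∧ Disjoint (closure A₁)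 A₂ ∧ (∀ x ∈ B, h x = x) ∧ ∃ (hhA₁ : Set.MapsTo (h : C(ComplexPoints (fiberOver π b), ComplexPoints (fiberOver π b))) A₁ A₁) (hhA₂ : Set.MapsTo (h : C(ComplexPoints (fiberOver π b), ComplexPoints (fiberOver π b))) A₂ A₂) (hτA₁ : Set.MapsTo (AlgPoints.mapContinuous (L := ℂ) (fiberOverEnd π τ hτπ b)) A₁ A₁) (hτA₂ : Set.MapsTo (AlgPoints.mapContinuous (L := ℂ) (fiberOverEnd π τ hτπ b)) A₂ A₂) (_ : Set.MapsTo (AlgPoints.mapContinuous (L := ℂ) (fiberOverEnd π j hjπ b)) A₁ A₂) (_ : Set.MapsTo (AlgPoints.mapContinuous (L := ℂ) (fiberOverEnd π j hjπ b)) A₂ A₁) (_ : Module.Finite ℚ (singularHomology ℚ ℚ (↥A₁) 2)) (_ : Module.Finite ℚ (singularHomology ℚ ℚ (↥A₂) 2)), Module.finrank ℚ ↥(Module.End.eigenspace ((singularHomology.map ℚ ℚ (singularHomology.restrictSelf (AlgPoints.mapContinuous (L := ℂ) (fiberOverEnd π τ hτπ b)) hτA₁) 2).hom ^ 2) (-1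 : ℚ)) ≤ 2 ∧ (∀ a : singularHomology ℚ ℚ (↥A₁) 2, singularHomology.map ℚ ℚ (singularHomology.restrictSelf (AlgPoints.mapContinuous (L := ℂ) (fiberOverEnd π τ hτπ b)) hτA₁) 2 (singularHomology.map ℚ ℚ (singularHomology.restrictSelf (AlgPoints.mapContinuous (L := ℂ) (fiberOverEnd π τ hτπ b)) hτA₁) 2 a) = -a → singularHomology.map ℚ ℚ (singularHomology.restrictSelf (h : C(ComplexPoints (fiberOver π b), ComplexPoints (fiberOver π b))) hhA₁) 2 a = singularHomology.map ℚ ℚ (singularHomology.restrictSelf (AlgPoints.mapContinuous (L := ℂ) (fiberOverEnd π τ hτπ b)) hτA₁) 2 a) ∧ (∀ a : singularHomology ℚ ℚ (↥A₂) 2, singularHomology.map ℚ ℚ (singularHomology.restrictSelf (AlgPoints.mapContinuous (L := ℂ) (fiberOverEnd π τ hτπ b)) hτA₂) 2 (singularHomology.map ℚ ℚ (singularHomology.restrictSelf (AlgPoints.mapContinuous (L := ℂ) (fiberOverEnd π τ hτπ b)) hτA₂) 2 a) = -a → singularHomology.map ℚ ℚ (singularHomology.restrictSelf (h : C(ComplexPoints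 (fiberOver π b), ComplexPoints (fiberOver π b))) hhA₂) 2 (singularHomology.map ℚ ℚ (singularHomology.restrictSelf (AlgPoints.mapContinuous (L := ℂ) (fiberOverEnd π τ hτπ b)) hτA₂) 2 a) = a))
    (hcdk : open Literature.AlgebraicGeometry.HodgeTheory in cmsp_nonHodgeGenericPoints_countable_algebraic_cover)
    (hdel : Literature.AlgebraicGeometry.HodgeTheory.deligne1987_monodromy_directSum_irreducible_subvariations) :
    Summit.HodgeConjecture.HodgeConjecture.Theses.Q8SymplecticPowers.VeryGeneralQuaternionCommutatorsInHg := by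
  refine Q8SymplecticPowersK1QPointwise.VeryGeneralQuaternionCommutatorsInHg_of_pointwise ?_
  intro Uni Comm e he h4
  by_cases he4 : e = 4
  · exact K1Q_at_four_of_dense_bettiRegularMembers (@HZ 4 (by norm_num) le_rfl) h₉₄ @hcdk @hdel he4
  · exact Q8SymplecticPowersK1QPointwise.K1Q_at_ge6_of_residues
      (fun e' he' h6' => regularAt_of_dense_bettiRegularMembers (by omega) (HZ he' (by omega))) h₉₆ @hcdk @hdel he
      (by rcases he with ⟨r, hr⟩; omega)

end Summit.HodgeConjecture.HodgeConjecture.Theorems.Q8SymplecticPowersRegularAt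

end
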